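import Mathlib.Topology.TietzeExtension
import Mathlib.Analysis.Complex.Tietze
import Mathlib.Topology.Instances.Matrix
import Mathlib.Topology.UrysohnsLemma
import Mathlib.Topology.UnitInterval
import Mathlib.LinearAlgebra.Matrix.NonsingularInverse
import Mathlib.Analysis.Complex.Basic
import Mathlib.Topology.Algebra.Ring.Basic
import HarnessLib

/-!
# Extension of null-homotopic maps into `GLₙ(ℂ)` over compact Hausdorff spaces

Let `X` be compact Hausdorff and `A ⊆ X` closed. A continuous map `g : A → Mₙ(ℂ)` with invertible
values which is homotopic *through such maps* to the constant map `1` extends to a continuous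
invertible-valued map on all of `X` (`exists_extension_of_homotopic_one`; the homotopy form is
`exists_extension_of_nullhomotopic`). This is the homotopy extension property of the pair
`(X, A)` for maps into the open set `GLₙ(ℂ) ⊆ Mₙ(ℂ)`, proved directly: Tietze-extend the
homotopy to `X × [0,1]` (Mathlib's `ContinuousMap.exists_restrict_eq`, `TietzeExtension` for
matrices), renormalise it to be `1` at time `1`, observe that the set of points whose whole time
segment is invertible is an open neighbourhood of `A` (generalised tube lemma), and reparametrise
time by an Urysohn function. Everything is proved; no named facts. Used for clutching over
spheres and `K̃(S¹) = 0` in topological `K`-theory.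

## References

* A. Hatcher, *Vector Bundles and K-Theory* (v2.2, 2017), §1.2, proof of Prop. 1.11 (extension
  of clutching data using that `GLₙ(ℂ)` is open / a neighbourhood retract). Standard; folklore.

## Design notes

* Values are in `Matrix n n ℂ` with the invertibility predicate `IsUnit (det M)`, matching the
  matrix-valued clutching functions of `Literature/AlgebraicTopology/KTheory/`.
* Mathlib searches: `ContinuousMap.exists_restrict_eq`, `generalized_tube_lemma`,
  `exists_continuous_zero_one_of_isClosed`, `Continuous.matrix_det` (used); Mathlib has the
  abstract `HomotopyExtensionProperty`-style results only for CW complexes / cofibrations, not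
  this Tietze form. Nothing restated.
-/

noncomputable section

open Set unitInterval Topology

namespace Literature.AlgebraicTopology.KTheory

universe u

variable {X : Type u} [TopologicalSpace X] [CompactSpace X] [T2Space X]
variable {n : Type*} [Fintype n] [DecidableEq n]

/-- **Extension of null-homotopic invertible-matrix-valued maps.** Let `X` be compact Hausdorff,
`A ⊆ X` closed and `h : A × [0,1] → Mₙ(ℂ)` a continuous family of *invertible* matrices with
`h(a, 1) = 1`. Then `h(·, 0)` extends to a continuous map `G : X → Mₙ(ℂ)` with invertible values
(and `G = 1` far from `A`). Proof: Tietze-extend `h` to `X × [0,1]`, renormalise so that the value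
at `t = 1` is `1` everywhere, note that the set `W` of `x` whose whole segment is invertible is an
open neighbourhood of `A` (tube lemma), and set `G(x) = H̃(x, 1 - φ(x))` for an Urysohn function
`φ` equal to `1` on `A` and `0` off `W`. [folklore] -/
theorem exists_extension_of_nullhomotopic {A : Set X} (hA : IsClosed A)
    (h : C(A × I, Matrix n n ℂ)) (hinv : ∀ z, IsUnit (h z).det) (h1 : ∀ a, h (a, 1) = 1) :
    ∃ G : C(X, Matrix n n ℂ), (∀ x, IsUnit (G x).det) ∧ ∀ a : A, G a = h (a, 0) := by
  -- Tietze on the closed set `A × I ⊆ X × I`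
  have hAI : IsClosed (A ×ˢ (univ : Set I)) := hA.prod isClosed_univ
  let e : ↥(A ×ˢ (univ : Set I)) ≃ₜ A × I :=
    { toFun := fun z ↦ (⟨z.1.1, z.2.1⟩, z.1.2)
      invFun := fun z ↦ ⟨(z.1.1, z.2), z.1.2, mem_univ _⟩
      left_inv := fun _ ↦ rfl
      right_inv := fun _ ↦ rfl
      continuous_toFun := by fun_prop
      continuous_invFun := by fun_prop }
  obtain ⟨H₀, hH₀⟩ := ContinuousMap.exists_restrict_eq hAI (h.comp (e : C(↥(A ×ˢ (univ : Set I)), A × I)))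
  have hH₀A : ∀ (a : A) (t : I), H₀ ((a : X), t) = h (a, t) := fun a t ↦ by
    have := congrFun (congrArg DFunLike.coe hH₀) ⟨((a : X), t), a.2, mem_univ _⟩
    exact this
  -- renormalise: `H (x, 1) = 1`
  let H : C(X × I, Matrix n n ℂ) :=
    ⟨fun z ↦ H₀ z - H₀ (z.1, 1) + 1, by fun_prop⟩
  have hHA : ∀ (a : A) (t : I), H ((a : X), t) = h (a, t) := fun a t ↦ by
    simp only [H, ContinuousMap.coe_mk, hH₀A, h1, sub_add_cancel]
  have hH1 : ∀ x, H (x, 1) = 1 := fun x ↦ by simp [H]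
  -- the good set
  let U : Set (X × I) := {z | IsUnit (H z).det}
  have hU : IsOpen U := by
    have : U = (fun z ↦ (H z).det) ⁻¹' {c | IsUnit c} := rfl
    rw [this]
    refine IsOpen.preimage (H.continuous.matrix_det) ?_
    simp only [isUnit_iff_ne_zero]
    exact isOpen_ne
  let W : Set X := {x | ∀ t : I, (x, t) ∈ U}
  have hW : IsOpen W := by
    have : W = {x | ({x} : Set X) ×ˢ (univ : Set I) ⊆ U} := by
      ext x; simp [W, prod_subset_iff]
    rw [this, isOpen_iff_mem_nhds]
    intro x hx
    obtain ⟨u, v, hu, -, hxu, htv, huv⟩ := generalized_tube_lemma isCompact_singleton isCompact_univ hU hx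
    refine Filter.mem_of_superset (hu.mem_nhds (hxu rfl)) fun y hy ↦ ?_
    rintro ⟨y', t⟩ ⟨hy', -⟩
    rw [mem_singleton_iff] at hy'
    subst hy'
    exact huv ⟨hy, htv (mem_univ t)⟩
  have hAW : A ⊆ W := fun a ha t ↦ by
    change IsUnit (H (a, t)).det
    rw [hHA ⟨a, ha⟩ t]
    exact hinv _
  -- Urysohn function: `0` off `W`, `1` on `A`
  obtain ⟨f, hf0, hf1, hf01⟩ := exists_continuous_zero_one_of_isClosed hW.isClosed_compl hA
    (disjoint_compl_left.mono_right hAW)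
  let τ : C(X, I) := ⟨fun x ↦ unitInterval.symm ⟨f x, hf01 x⟩, by fun_prop⟩
  have hτ0 : ∀ x ∉ W, τ x = 1 := fun x hx ↦ by
    apply Subtype.ext
    simp [τ, hf0 hx]
  have hτA : ∀ a ∈ A, τ a = 0 := fun a ha ↦ by
    apply Subtype.ext
    simp [τ, hf1 ha]
  refine ⟨⟨fun x ↦ H (x, τ x), by fun_prop⟩, fun x ↦ ?_, fun a ↦ ?_⟩
  · by_cases hx : x ∈ W
    · exact hx (τ x)
    · change IsUnit (H (x, τ x)).det
      rw [hτ0 x hx, hH1]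
      simp
  · change H ((a : X), τ a) = h (a, 0)
    rw [hτA a a.2, hHA]

/-- **Maps into `GLₙ(ℂ)` that are null-homotopic extend**: if `g : A → Mₙ(ℂ)` takes invertible
values and is homotopic, through such maps, to the constant map `1`, then `g` extends to a
continuous invertible-matrix-valued map on `X` (compact Hausdorff, `A` closed). [folklore] -/
theorem exists_extension_of_homotopic_one {A : Set X} (hA : IsClosed A) (g : C(A, Matrix n n ℂ))
    (F : C(A × I, Matrix n n ℂ)) (hF : ∀ z, IsUnit (F z).det) (hF0 : ∀ a, F (a, 0) = g a)
    (hF1 : ∀ a, F (a, 1) = 1) :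
    ∃ G : C(X, Matrix n n ℂ), (∀ x, IsUnit (G x).det) ∧ ∀ a : A, G a = g a := by
  obtain ⟨G, hG, hGA⟩ := exists_extension_of_nullhomotopic hA F hF hF1
  exact ⟨G, hG, fun a ↦ (hGA a).trans (hF0 a)⟩

end Literature.AlgebraicTopology.KTheory

end
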